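import Summits.BirchSwinnertonDyer.BirchSwinnertonDyer.Theorems.SemiOrdinaryEisensteinDescentWildKolyvaginUpperAtThreeTowerFreeJetchevMaxModThree
import Summits.BirchSwinnertonDyer.BirchSwinnertonDyer.Theorems.SemiOrdinaryEisensteinDescentWildKolyvaginUpperAtThreeOfThreePrimitives
import Summits.BirchSwinnertonDyer.BirchSwinnertonDyer.Theorems.PoitouTateSelmerStructureDualityConjHolds
import Summits.BirchSwinnertonDyer.BirchSwinnertonDyer.Theorems.SemiOrdinaryEisensteinDescentEisensteinKernelAtThreeOfValueAtOneV
import Summits.BirchSwinnertonDyer.BirchSwinnertonDyer.Theorems.SemiOrdinaryEisensteinDescentShaTwoCochainShell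
import Summits.BirchSwinnertonDyer.BirchSwinnertonDyer.Theorems.SemiOrdinaryEisensteinDescentShaTwoCochainBridgeAssemblyCriterion
import Summits.BirchSwinnertonDyer.BirchSwinnertonDyer.Theorems.SemiOrdinaryEisensteinDescentShaTwoCochainClassReadout
import HarnessLib

set_option linter.dupNamespace false -- `…BirchSwinnertonDyer.BirchSwinnertonDyer…` is the cell's nested layout (D-0017)
set_option autoImplicit false

/-!
# The SOED Kolyvagin column AFTER Cassels–Tate (item 20191 CLOSED 2026-08-28): Ko′ 24696, J′ 24702, Ko 20480,
# `KolyvaginPrimitivesAtThree` 25896 and the rung, BY NAME from the research crux J‴ 25898 (resp. J 20760) and the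
# TWO remaining Gross print items ONLY

Width seat `bsd-wall-soed-p2-w2` (gen 12, lead-of-record lineage of J‴ stmt-BirchSwinnertonDyer-25898
`WildSigmaDivisibilityAtThreeMultiCarrier`; explicit unit, no claim), route `SemiOrdinaryEisensteinDescent` (rev 25),
`--workitem stmt-BirchSwinnertonDyer-24696` (CONDITIONAL result for Ko′; the other theorems ride along). THEOREMS ONLY (no
definition, no named fact, no `sorry`); every theorem is ONE term over landed declarations — this file is the column's
post-Cassels–Tate LEDGER in the kernel, not new mathematics.

WHAT CHANGED ON 2026-08-28. The two duality inputs the column displayed since rev 14 are now tree theorems: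
* Poitou–Tate for Selmer structures, conjugation-compatible currency, every `K` (Milne *ADT* I 4.10 (b), Cor. 2.3, Thm. 2.6;
  Howard 2004 Thm. 2.1.11): `InputsPoitouTateSelmer.poitouTate_selmerStructure_duality_conj_holds` (cell bsd-schneider; items
  20461 / 23092 CLOSED) — restated below as the route item `PoitouTateSelmerDualityConjInput` BY NAME;
* the levelwise Cassels–Tate inputs for THE canonical local invariant maps, every `K` (Milne *ADT* I §6 Prop. 6.9, Thm. 6.13,
  with I 4.10 (a)(c); Cassels 1962; Tate 1962; Gross 1991 §5 (5.1)): `ShaTwoCochainTheta.CasselsTateLevelInputsFact_proof`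
  (p648480, the CT-20191 Ш²-cochain bridge of the width seats soed-p2-w3 g7 / w4 g2 / w2 g11 / w5 g6–g7 / w3 g8; item 20191
  CLOSED·proved 2026-08-28T16:30:59Z).
Plugging both in BY NAME (and the glue 26257's one-line term + the landed closer of the kernel-V 26611):

| item | follows from (this file) | term |
|---|---|---|
| J′ 24702 `WildSigmaDivisibilityAtThreeTowerFree` | 23091 ∧ 24701 ∧ J‴ 25898 | p606426 §4 `…_of_sigmaMultiCarrier_of_threePrintFacts` |
| Ko′ 24696 `WildKolyvaginUpperAtThreeTowerFree` | 23091 ∧ 24701 ∧ J‴ 25898 | p606426 §4 `…_of_sigmaMultiCarrier_of_fourPrimitives` |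
| Ko 20480 `WildKolyvaginUpperAtThree` (tower) | 23091 ∧ 24701 ∧ J 20760 | p591367 `…_of_sigma_of_threePrimitives` |
| 25896 `KolyvaginPrimitivesAtThree` | 23091 ∧ 24701 | `⟨CT, ·, ·⟩` |
| rung `WAllExclAddWildRankOneSurj` | hIn ∧ hW ∧ 23091 ∧ 24701 ∧ E_𝟙^V 26610 ∧ J‴ 25898 ∧ Z 20387 | the route's `closes` |

So after 2026-08-28 the Kolyvagin column's displayed debt is EXACTLY: research J‴ 25898 (= line `birth`'s
`stub_flatMultiCarrier` on the census habitat `N ≤ 5·10⁵`, Büyükboduk 2009 §4.2 Q1 at the additive prime 3, ⊕ Manin₃ off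
Cremona's range) and print {Gross 1991 Prop. 3.7 (2) = item 23091, Gross 1991 §6 / GZ86 III (3.1) `E⁰` = item 24701} (plus
Cremona's `|c| = 1` for `N ≤ 5·10⁵` inside line `birth`). Poitou–Tate and Cassels–Tate appear in NO hypothesis of the column any more.

Honest framing: every theorem here is CONDITIONAL on its displayed hypotheses (open research items and cite-only print items,
stated as the ROUTE ITEMS by name); nothing is asserted about any curve unconditionally; Ko′, J′, Ko, J‴, J stay OPEN; no summit
statement is proved; the Birch–Swinnerton-Dyer conjecture is NOT proved by any of this. Cassels–Tate / Poitou–Tate are published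
theorems that the tree now proves.
References: [McCallumLMS1991] §5 Cor. 5.6; [GrossLMS1991] Prop. 3.7 (2), §6; [GrossZagier1986Heegner] III (3.1);
[Jetchev2008] Thm. 1.4, Conj. 1.3; [Buyukboduk2009TamagawaDefect] §4.2 Q1; [MilneADT2006] I 4.10, §6 6.9/6.13.
-/

noncomputable section

namespace Summit.BirchSwinnertonDyer.BirchSwinnertonDyer.Theorems.WildKolyvaginUpperAtThreeTowerFreeOfTwoPrintFacts

open Literature.NumberTheory.EllipticCurves Literature.NumberTheory.GaloisCohomology
  Summit.BirchSwinnertonDyer.BirchSwinnertonDyer.Theses.SemiOrdinaryEisensteinDescent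
  Summit.BirchSwinnertonDyer.BirchSwinnertonDyer.Theorems

/-- **Item 23092 `PoitouTateSelmerDualityConjInput` BY NAME** — Poitou–Tate duality for Selmer structures with a
conjugation-compatible family of local invariant maps, every number field: the tree theorem
`InputsPoitouTateSelmer.poitouTate_selmerStructure_duality_conj_holds` (cell bsd-schneider) read against the route item's text
(the item is CLOSED; restated here only as the by-name feed of the terms below, no new content).
[cite: MilneADT2006, Ch. I, Thm. 4.10 (b) (proof, p. 58), Cor. 2.3, Thm. 2.6] [cite: Howard2004HeegnerKolyvagin, Thm. 2.1.11] -/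
theorem poitouTateSelmerDualityConjInput_holds : PoitouTateSelmerDualityConjInput :=
  fun K _ _ => InputsPoitouTateSelmer.poitouTate_selmerStructure_duality_conj_holds K

/-- **Item 20191 `CasselsTateLevelInputsFact` BY NAME** — the levelwise Cassels–Tate inputs for THE canonical local invariant maps,
every number field: the SAME three-constant term as the item's closer `ShaTwoCochainTheta.CasselsTateLevelInputsFact_proof` /
`casselsTate_levelInputs_of_shaTwoCochainBridge` (p648480, soed-p2-w4 g2; item CLOSED·proved 2026-08-28T16:30:59Z), written over
its three ROUTE-INDEPENDENT modules (`…ShaTwoCochainShell`, `…BridgeAssemblyCriterion`, `…ClassReadout`) so that this file does not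
import the closer module's three other route files (`lint.theses-cone`). No new content; restated only as the by-name feed below.
[cite: MilneADT2006, Ch. I Thm. 4.10 (a)(c), §6 Prop. 6.9, Thm. 6.13 (a)(b)] [cite: Cassels1962ArithmeticIV] [cite: Tate1963DualityICM]
[cite: GrossLMS1991, §5 (5.1)] -/
theorem casselsTateLevelInputsFact_holds : CasselsTateLevelInputsFact :=
  fun K _ _ => ShaTwoCochainTheta.casselsTate_levelInputs_of_readout_vanishing_flip K
    (ShaTwoCochainTheta.hbridge_of_readout_criterion K (ShaTwoCochain.classBarInv_readout_eq_zero_of_criterion K))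

/-- **J′ (item 24702 `WildSigmaDivisibilityAtThreeTowerFree`) BY NAME ⟸ item 23091 (Gross 1991 Prop. 3.7 (2)) + item 24701
(GZ86 III (3.1) / `E⁰`) + J‴ (item 25898)** — p606426 §4 with Poitou–Tate DISCHARGED (`poitouTateSelmerDualityConjInput_holds`):
on a single-carrier frame Jetchev's max-form mod 3, on a multi-carrier frame J‴. CONDITIONAL on the three items (two cite-only
print, one open research); J′ stays open. [cite: Jetchev2008, Thm. 1.4 and Conj. 1.3 (p. 812)] [cite: GrossLMS1991, Prop. 3.7 (2) (p. 240), §6 (p. 245)] -/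
theorem wildSigmaDivisibilityAtThreeTowerFree_of_sigmaMultiCarrier_of_twoPrintFacts
    (h372 : GrossProp372FrobeniusCongruenceInput) (hE0 : GrossHeegnerPointE0Input)
    (hJ : WildSigmaDivisibilityAtThreeMultiCarrier) : WildSigmaDivisibilityAtThreeTowerFree :=
  WildKolyvaginUpperAtThreeTowerFreeJetchevMaxModThree.wildSigmaDivisibilityAtThreeTowerFree_of_sigmaMultiCarrier_of_threePrintFacts
    poitouTateSelmerDualityConjInput_holds hE0 h372 hJ

/-- **Ko′ (item 24696 `WildKolyvaginUpperAtThreeTowerFree`) BY NAME ⟸ item 23091 + item 24701 + J‴ (item 25898)** — p606426 §4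
`…_of_sigmaMultiCarrier_of_fourPrimitives` with Cassels–Tate := `casselsTateLevelInputsFact_holds` (= p648480's closer term; item 20191
CLOSED) and Poitou–Tate := `poitouTateSelmerDualityConjInput_holds`. CONDITIONAL on the three items; Ko′ stays open; this is the
column's aside of record re-plugged, not a proof of it. [cite: McCallumLMS1991, §5 Cor. 5.6 (p. 310)]
[cite: Jetchev2008, Thm. 1.4 and Conj. 1.3 (p. 812)] [cite: Buyukboduk2009TamagawaDefect, §4.2 Question 1] -/
theorem wildKolyvaginUpperAtThreeTowerFree_of_sigmaMultiCarrier_of_twoPrintFacts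
    (h372 : GrossProp372FrobeniusCongruenceInput) (hE0 : GrossHeegnerPointE0Input)
    (hJ : WildSigmaDivisibilityAtThreeMultiCarrier) : WildKolyvaginUpperAtThreeTowerFree :=
  WildKolyvaginUpperAtThreeTowerFreeJetchevMaxModThree.wildKolyvaginUpperAtThreeTowerFree_of_sigmaMultiCarrier_of_fourPrimitives
    casselsTateLevelInputsFact_holds h372 hE0 poitouTateSelmerDualityConjInput_holds hJ

/-- **Ko (item 20480 `WildKolyvaginUpperAtThree`, tower form) BY NAME ⟸ item 23091 + item 24701 + J (item 20760
`WildSigmaDivisibilityAtThree`)** — p591367 `…_of_sigma_of_threePrimitives` with Cassels–Tate :=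
`casselsTateLevelInputsFact_holds`; = the composition of line `birth` v5 of crux Ko. CONDITIONAL on the three
items; Ko stays open. [cite: McCallumLMS1991, §5 Cor. 5.6 (p. 310)] [cite: GrossLMS1991, Prop. 3.7 (2) (p. 240), §6 (p. 245)] -/
theorem wildKolyvaginUpperAtThree_of_sigma_of_twoPrintFacts
    (h372 : GrossProp372FrobeniusCongruenceInput) (hE0 : GrossHeegnerPointE0Input)
    (hσ : WildSigmaDivisibilityAtThree) : WildKolyvaginUpperAtThree :=
  WildKolyvaginUpperAtThreeOfThreePrimitives.wildKolyvaginUpperAtThree_of_sigma_of_threePrimitives hσ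
    casselsTateLevelInputsFact_holds h372 hE0

/-- **Item 25896 `KolyvaginPrimitivesAtThree` ⟸ item 23091 + item 24701** (its Cassels–Tate conjunct is the tree theorem
`casselsTateLevelInputsFact_holds`). CONDITIONAL on the two cite-only Gross items; 25896 stays open until
they are formalised. [cite: GrossLMS1991, Prop. 3.7 (2) (p. 240) and §6, proof of Prop. 6.2 (1) (p. 245)]
[cite: GrossZagier1986Heegner, III (3.1) Proposition, p. 256] -/
theorem kolyvaginPrimitivesAtThree_of_twoPrintFacts
    (h372 : GrossProp372FrobeniusCongruenceInput) (hE0 : GrossHeegnerPointE0Input) :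
    KolyvaginPrimitivesAtThree :=
  ⟨casselsTateLevelInputsFact_holds, h372, hE0⟩

/-- **The rung `WAllExclAddWildRankOneSurj` BY NAME from the route's OPEN items only** (post-Cassels–Tate normal form of
`Theses.SemiOrdinaryEisensteinDescent.closes`): published inputs `hIn`, the printed-inputs package `hW`, the two Gross items, the
Eisenstein value crux E_𝟙^V (26610), J‴ (25898) and the rank-zero residual Z (20387) — with Poitou–Tate (both currencies:
`poitouTateSelmerDualityConjInput_holds` and `poitouTate_selmerStructure_duality_of_conj` of it), Cassels–Tate
(`casselsTateLevelInputsFact_holds`) and the Jetchev max-form item 25897 (its one-line term `jetchevMaxModThree_of_literature`, = glue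
26257) supplied BY NAME, fed to the kernel-V term of p609065 §3
(`EisensteinKernelAtThreeOfValueAtOneV.wAllExclAddWildRankOneSurj_of_valueAtOneV_of_sigmaMultiCarrier_of_jetchevMaxModThree_of_primitives_of_poitouTate`,
= the closer of 26611 — imported from its route-closer-free module). CONDITIONAL on seven displayed hypotheses (three research cruxes,
four print packages); the rung is NOT proved; BSD is not proved by this.
[cite: JetchevSkinnerWan2017, §7.4.1–7.4.2] [cite: McCallumLMS1991, §5 Cor. 5.6] [cite: Jetchev2008, Thm. 1.4, Conj. 1.3] -/
theorem wAllExclAddWildRankOneSurj_of_research_of_twoPrintFacts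
    (hIn : PublishedInputsWildThree) (hW : WildSplitPrintedInputsAtThree)
    (h372 : GrossProp372FrobeniusCongruenceInput) (hE0 : GrossHeegnerPointE0Input)
    (hE1V : WildSplitEisensteinValueAtOneV) (hJ : WildSigmaDivisibilityAtThreeMultiCarrier)
    (hZ : WildRankZeroTwistAtThree) : Summit.BirchSwinnertonDyer.WAllExclAddWildRankOneSurj :=
  EisensteinKernelAtThreeOfValueAtOneV.wAllExclAddWildRankOneSurj_of_valueAtOneV_of_sigmaMultiCarrier_of_jetchevMaxModThree_of_primitives_of_poitouTate
    hIn hE1V ⟨casselsTateLevelInputsFact_holds, h372, hE0⟩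
    (fun _ hE0' h372' =>
      WildKolyvaginUpperAtThreeTowerFreeJetchevMaxModThree.jetchevMaxModThree_of_literature
        poitouTateSelmerDualityConjInput_holds hE0' h372')
    hJ hW (fun K _ _ => poitouTate_selmerStructure_duality_of_conj (poitouTateSelmerDualityConjInput_holds K)) hZ

end Summit.BirchSwinnertonDyer.BirchSwinnertonDyer.Theorems.WildKolyvaginUpperAtThreeTowerFreeOfTwoPrintFacts

end
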